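import Summits.CriticalPhenomena.PercolationContinuityZ3.Theorems.PercNearOneGluingNoHeavyLowerTailSahiGridPatternOrthantGrid
import Summits.CriticalPhenomena.PercolationContinuityZ3.Theorems.PercNearOneGluingNoHeavyLowerTailSahiGridPatternTwoSetsTop

/-!
# `NoHeavyLowerTail` (crux stmt-CriticalPhenomena-4575), Sahi programme: CO-LIFTS OF THE PATTERN FUNCTIONAL — bookkeeping
# (per-axis count table, reorderings, normalisation of whole-cube atoms)

Support file (seat `prim-sahi-p1`, generation 9; `--supports stmt-CriticalPhenomena-4575`).  Pure proofs, no definitions, no `sorry`,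
standard axioms.  Shared bookkeeping for the three co-lift files `…SahiGridPatternCoTop` (`(D,⊤,⊤)`), `…CoMid` (`(D,D,⊤)`),
`…MidTop` (`(∅,D,⊤)`): the full table of per-axis counts `c1 c2 c3` (27 level blocks), factor reorderings of pair sums, the count
`#{p : p δ̸ q} = 2^n`, and the normalisations of the atoms whose first set is the whole cube (`N(⊤;X,Y) = 2^n|X∩Y|`,
`N(X;⊤,Y) = N(Y;⊤,X) = L(⊤;X,Y) = N(X,Y)`). [this work]
-/

namespace Summit.CriticalPhenomena.PercolationContinuityZ3.Theorems.SahiGridPattern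

open Finset SahiGrid3
open scoped BigOperators

variable {n : ℕ}

/-! ### Bookkeeping -/

/-- Per-axis count values, first half (bookkeeping for the 27 level blocks). [this work] -/
theorem c_vals_all₁ :
    c1 (0:Fin 3) 0 0 = 2 ∧
    c2 (0:Fin 3) 0 0 = 0 ∧
    c3 (0:Fin 3) 0 0 = 0 ∧
    c1 (0:Fin 3) 0 1 = 0 ∧
    c2 (0:Fin 3) 0 1 = 0 ∧
    c2 (1:Fin 3) 0 0 = 1 ∧
    c3 (0:Fin 3) 0 1 = 0 ∧
    c1 (0:Fin 3) 0 2 = 0 ∧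
    c2 (0:Fin 3) 0 2 = 0 ∧
    c2 (2:Fin 3) 0 0 = 1 ∧
    c3 (0:Fin 3) 0 2 = 0 ∧
    c1 (0:Fin 3) 1 0 = 0 ∧
    c2 (0:Fin 3) 1 0 = 0 ∧
    c3 (0:Fin 3) 1 0 = 0 ∧
    c1 (0:Fin 3) 1 1 = 0 ∧
    c2 (0:Fin 3) 1 1 = 1 ∧
    c2 (1:Fin 3) 0 1 = 0 ∧
    c3 (0:Fin 3) 1 1 = 0 ∧
    c1 (0:Fin 3) 1 2 = 0 ∧
    c2 (0:Fin 3) 1 2 = 0 ∧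
    c2 (1:Fin 3) 0 2 = 0 ∧
    c2 (2:Fin 3) 0 1 = 0 ∧
    c3 (0:Fin 3) 1 2 = 1 ∧
    c1 (0:Fin 3) 2 0 = 0 ∧
    c2 (0:Fin 3) 2 0 = 0 ∧
    c3 (0:Fin 3) 2 0 = 0 ∧
    c1 (0:Fin 3) 2 1 = 0 ∧
    c2 (0:Fin 3) 2 1 = 0 ∧
    c3 (0:Fin 3) 2 1 = 1 ∧
    c1 (0:Fin 3) 2 2 = 0 ∧
    c2 (0:Fin 3) 2 2 = 1 ∧
    c2 (2:Fin 3) 0 2 = 0 ∧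
    c3 (0:Fin 3) 2 2 = 0 ∧
    c1 (1:Fin 3) 0 0 = 0 ∧
    c3 (1:Fin 3) 0 0 = 0 ∧
    c1 (1:Fin 3) 0 1 = 0 ∧
    c2 (1:Fin 3) 1 0 = 0 ∧
    c3 (1:Fin 3) 0 1 = 0 ∧
    c1 (1:Fin 3) 0 2 = 0 ∧
    c2 (2:Fin 3) 1 0 = 0 ∧
    c3 (1:Fin 3) 0 2 = 1 := by
  unfold c1 c2 c3; decide

/-- Per-axis count values, second half. [this work] -/
theorem c_vals_all₂ :
    c1 (1:Fin 3) 1 0 = 0 ∧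
    c3 (1:Fin 3) 1 0 = 0 ∧
    c1 (1:Fin 3) 1 1 = 2 ∧
    c2 (1:Fin 3) 1 1 = 0 ∧
    c3 (1:Fin 3) 1 1 = 0 ∧
    c1 (1:Fin 3) 1 2 = 0 ∧
    c2 (1:Fin 3) 1 2 = 0 ∧
    c2 (2:Fin 3) 1 1 = 1 ∧
    c3 (1:Fin 3) 1 2 = 0 ∧
    c1 (1:Fin 3) 2 0 = 0 ∧
    c2 (1:Fin 3) 2 0 = 0 ∧
    c3 (1:Fin 3) 2 0 = 1 ∧
    c1 (1:Fin 3) 2 1 = 0 ∧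
    c2 (1:Fin 3) 2 1 = 0 ∧
    c3 (1:Fin 3) 2 1 = 0 ∧
    c1 (1:Fin 3) 2 2 = 0 ∧
    c2 (1:Fin 3) 2 2 = 1 ∧
    c2 (2:Fin 3) 1 2 = 0 ∧
    c3 (1:Fin 3) 2 2 = 0 ∧
    c1 (2:Fin 3) 0 0 = 0 ∧
    c3 (2:Fin 3) 0 0 = 0 ∧
    c1 (2:Fin 3) 0 1 = 0 ∧
    c3 (2:Fin 3) 0 1 = 1 ∧
    c1 (2:Fin 3) 0 2 = 0 ∧
    c2 (2:Fin 3) 2 0 = 0 ∧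
    c3 (2:Fin 3) 0 2 = 0 ∧
    c1 (2:Fin 3) 1 0 = 0 ∧
    c3 (2:Fin 3) 1 0 = 1 ∧
    c1 (2:Fin 3) 1 1 = 0 ∧
    c3 (2:Fin 3) 1 1 = 0 ∧
    c1 (2:Fin 3) 1 2 = 0 ∧
    c2 (2:Fin 3) 2 1 = 0 ∧
    c3 (2:Fin 3) 1 2 = 0 ∧
    c1 (2:Fin 3) 2 0 = 0 ∧
    c3 (2:Fin 3) 2 0 = 0 ∧
    c1 (2:Fin 3) 2 1 = 0 ∧
    c3 (2:Fin 3) 2 1 = 0 ∧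
    c1 (2:Fin 3) 2 2 = 2 ∧
    c2 (2:Fin 3) 2 2 = 0 ∧
    c3 (2:Fin 3) 2 2 = 0 := by
  unfold c1 c2 c3; decide

/-- A difference of nested finsets in the THIRD-point slot of a Latin double sum (bookkeeping). [this work] -/
theorem sum2_ind_sdiff_third {x X : Finset (Pd n)} (h : x ⊆ X) {F G : Pd n → ℤ} {I : Pd n → Pd n → ℤ} :
    (∑ q, ∑ r, F q * G r * ind (X \ x) (thirdPt q r) * I q r) =
      (∑ q, ∑ r, F q * G r * ind X (thirdPt q r) * I q r) - ∑ q, ∑ r, F q * G r * ind x (thirdPt q r) * I q r := by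
  rw [← Finset.sum_sub_distrib]; refine Finset.sum_congr rfl fun q _ => ?_
  rw [← Finset.sum_sub_distrib]; refine Finset.sum_congr rfl fun r _ => ?_
  rw [ind_sdiff_of_subset h]; ring

/-- Reordering the two fibre factors of a pair sum (bookkeeping). [this work] -/
theorem reord2 (X Y Z : Finset (Pd n)) :
    (∑ p, ∑ q, ind X p * ind Y q * ind Z q * (if TotDist p q = true then (1:ℤ) else 0)) =
      ∑ p, ∑ q, ind X p * ind Z q * ind Y q * (if TotDist p q = true then (1:ℤ) else 0) :=
  Finset.sum_congr rfl fun p _ => Finset.sum_congr rfl fun q _ => by ring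

/-- Reordering a triple product in a single sum (bookkeeping). [this work] -/
theorem reord1 (X Y Z : Finset (Pd n)) :
    (∑ p, ind X p * ind Y p * ind Z p) = ∑ p, ind Y p * ind X p * ind Z p :=
  Finset.sum_congr rfl fun p _ => by ring

/-- Reordering a triple product in a single sum, second form (bookkeeping). [this work] -/
theorem reord1' (X Y Z : Finset (Pd n)) :
    (∑ p, ind X p * ind Y p * ind Z p) = ∑ p, ind Y p * ind Z p * ind X p :=
  Finset.sum_congr rfl fun p _ => by ring

/-- Swapping the two summation variables of a Latin double sum (bookkeeping). [this work] -/
theorem swapL (X Y Z : Finset (Pd n)) :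
    (∑ p, ∑ q, ind Y p * ind X q * ind Z (thirdPt p q) * (if TotDist p q = true then (1:ℤ) else 0)) =
      ∑ q, ∑ r, ind X q * ind Y r * ind Z (thirdPt q r) * (if TotDist q r = true then (1:ℤ) else 0) := by
  rw [Finset.sum_comm]
  refine Finset.sum_congr rfl fun q _ => Finset.sum_congr rfl fun r _ => ?_
  rw [thirdPt_comm r q, totDist_symm r q]; ring

/-- The number of points totally distinct from a given point is `2^n`. [this work] -/
theorem sum_totDist_one (q : Pd n) : (∑ p, (if TotDist p q = true then (1:ℤ) else 0)) = 2 ^ n := by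
  rw [← Finset.sum_filter, sum_totDist_eq_sum_sets q (fun _ => (1:ℤ))]
  simp [Finset.card_univ, Fintype.card_finset]

/-! ### Normalisation of the atoms whose first set is the whole cube -/

/-- `Σ_p 1_⊤(p) 1_X(p) 1_Y(p) = Σ_p 1_X 1_Y`. [this work] -/
theorem normT (X Y : Finset (Pd n)) : (∑ p, ind (univ : Finset (Pd n)) p * ind X p * ind Y p) = ∑ p, ind X p * ind Y p :=
  Finset.sum_congr rfl fun p _ => by unfold ind; rw [if_pos (Finset.mem_univ p)]; ring

/-- `N(⊤; X, Y) = 2^n · |X ∩ Y|`. [this work] -/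
theorem normNA (X Y : Finset (Pd n)) :
    (∑ p, ∑ q, ind (univ : Finset (Pd n)) p * ind X q * ind Y q * (if TotDist p q = true then (1:ℤ) else 0)) =
      2 ^ n * ∑ q, ind X q * ind Y q := by
  rw [Finset.sum_comm, Finset.mul_sum]
  refine Finset.sum_congr rfl fun q _ => ?_
  have e : ∀ p, ind (univ : Finset (Pd n)) p * ind X q * ind Y q * (if TotDist p q = true then (1:ℤ) else 0) =
      (ind X q * ind Y q) * (if TotDist p q = true then (1:ℤ) else 0) := by
    intro p; unfold ind; rw [if_pos (Finset.mem_univ p)]; ring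
  rw [Finset.sum_congr rfl fun p _ => e p, ← Finset.mul_sum, sum_totDist_one]; ring

/-- `N(X; ⊤, Y) = N(X, Y)`. [this work] -/
theorem normNB (X Y : Finset (Pd n)) :
    (∑ p, ∑ q, ind X p * ind (univ : Finset (Pd n)) q * ind Y q * (if TotDist p q = true then (1:ℤ) else 0)) =
      ∑ p, ∑ q, ind X p * ind Y q * (if TotDist p q = true then (1:ℤ) else 0) :=
  Finset.sum_congr rfl fun p _ => Finset.sum_congr rfl fun q _ => by unfold ind; rw [if_pos (Finset.mem_univ q)]; ring

/-- `N(Y; ⊤, X) = N(X, Y)`. [this work] -/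
theorem normNC (X Y : Finset (Pd n)) :
    (∑ p, ∑ q, ind Y p * ind (univ : Finset (Pd n)) q * ind X q * (if TotDist p q = true then (1:ℤ) else 0)) =
      ∑ p, ∑ q, ind X p * ind Y q * (if TotDist p q = true then (1:ℤ) else 0) := by
  rw [Finset.sum_comm]
  refine Finset.sum_congr rfl fun p _ => Finset.sum_congr rfl fun q _ => ?_
  unfold ind; rw [if_pos (Finset.mem_univ p), totDist_symm q p]; ring

/-- `L(⊤; X, Y) = N(X, Y)` (every totally distinct pair has its third point in the cube). [this work] -/
theorem normL (X Y : Finset (Pd n)) :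
    (∑ q, ∑ r, ind X q * ind Y r * ind (univ : Finset (Pd n)) (thirdPt q r) * (if TotDist q r = true then (1:ℤ) else 0)) =
      ∑ p, ∑ q, ind X p * ind Y q * (if TotDist p q = true then (1:ℤ) else 0) :=
  Finset.sum_congr rfl fun q _ => Finset.sum_congr rfl fun r _ => by unfold ind; rw [if_pos (Finset.mem_univ _)]; ring


end Summit.CriticalPhenomena.PercolationContinuityZ3.Theorems.SahiGridPattern
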